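import Summits.AtomisticToContinuum.Crystallization.Theorems.PhononSlackCertificatesPeriodicGivenLayeredExtraction1

/-!
# `PeriodicGivenLayered` (stmt-AtomisticToContinuum-11779), line `Sketch` — extraction, part 2:
# perturbing the data of a layered set, and the compact data space

Support file for the stub `stub_extraction` of the line `Sketch` of `PeriodicGivenLayered`
(part 1: `…PeriodicGivenLayeredExtraction1`). For NORMALISED data (`z 0 ∈ [−17a/20, 0]`,
increments in `[39a/50, 17a/20]`):

* `ext_abs_height_le_norm`, `ext_layer_bound` — the points of the layered set in `‖·‖ ≤ R + 1`
  come from the layers `|m| ≤ M` as soon as `R + 2 ≤ (39a/50) M`;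
* `ext_close_points` — if two data agree in the words and up to `η/4` in the heights on
  `|m| ≤ M`, and the rigid motions differ by `≤ η/4` on `‖·‖ ≤ R + 1`, every point of the first
  layered set in `‖·‖ ≤ R + 1` is within `η/2` of the second;
* `ext_match_perturb` — a two-way `η/2`-match on `‖·‖ ≤ R + 1` with a set `S` is a two-way
  `η`-match on `‖·‖ ≤ R` with any set two-way `η/2`-close to `S` on `‖·‖ ≤ R + 1` (`η ≤ 1`);
* `ext_isCompact_isometries`, `ext_isCompact_words`, `ext_isCompact_heights` — compactness of
  the three factors of the data space (linear isometries of `ℝ³` as a closed bounded subset of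
  `ℝ³ →L[ℝ] ℝ³`; `{±1}^ℤ`; normalised height sequences, by Tychonoff).

No definitions.
-/

noncomputable section

namespace Summit.AtomisticToContinuum.Crystallization.Theorems.LayeredHull

open scoped BigOperators
open Filter Topology Literature.MathematicalPhysics.StatisticalMechanics

/-! ## Which layers meet a ball -/

/-- The height of a layered point is at most its norm: the `e₃`-coordinate of the pre-image
`i u + j v + L w + h e₃` is `h`. [folklore] -/
theorem ext_abs_height_le_norm (A : EuclideanSpace ℝ (Fin 3) →ₗᵢ[ℝ] EuclideanSpace ℝ (Fin 3))
    (a L h : ℝ) (i j : ℤ) :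
    |h| ≤ ‖A (((i : ℝ) • triangularVec₁ a) + ((j : ℝ) • triangularVec₂ a) + (L • barlowOffset a) +
      (h • layerNormal 1))‖ := by
  rw [A.norm_map]
  have key := PiLp.norm_apply_le (((i : ℝ) • triangularVec₁ a) + ((j : ℝ) • triangularVec₂ a) +
      (L • barlowOffset a) + (h • layerNormal 1)) 2
  have h2 : (((i : ℝ) • triangularVec₁ a) + ((j : ℝ) • triangularVec₂ a) + (L • barlowOffset a) +
      (h • layerNormal 1)) 2 = h := by
    simp [triangularVec₁, triangularVec₂, barlowOffset, layerNormal]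
  rwa [h2, Real.norm_eq_abs] at key

/-- **Layers meeting a ball.** For normalised heights (`z 0 ∈ [−17a/20, 0]`, increments
`≥ 39a/50`, `0 < a ≤ 1`) and `R + 2 ≤ (39a/50) M`, a layer of height `|z m| ≤ R + 1` has
`|m| ≤ M`. [folklore] -/
theorem ext_layer_bound {z : ℤ → ℝ} {a R : ℝ} {M : ℕ} (ha0 : 0 < a) (ha1 : a ≤ 1)
    (hz : ∀ m : ℤ, 39 / 50 * a ≤ z (m + 1) - z m ∧ z (m + 1) - z m ≤ 17 / 20 * a)
    (hz0 : -(17 / 20 * a) ≤ z 0 ∧ z 0 ≤ 0) (hM : R + 2 ≤ 39 / 50 * a * M) {m : ℤ}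
    (hm : |z m| ≤ R + 1) : |m| ≤ M := by
  by_contra hlt
  rw [not_le, lt_abs] at hlt
  have hlo : 0 ≤ 39 / 50 * a := by positivity
  rcases le_or_gt 0 m with h0 | h0
  · obtain ⟨n, rfl⟩ := Int.eq_ofNat_of_zero_le h0
    have hn : (M : ℝ) + 1 ≤ n := by exact_mod_cast (by omega : M + 1 ≤ n)
    have hg := (ext_growth hz 0 n).1
    rw [zero_add] at hg
    have hmul : 39 / 50 * a * ((M : ℝ) + 1) ≤ 39 / 50 * a * n :=
      mul_le_mul_of_nonneg_left hn hlo
    have habs := le_abs_self (z n)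
    linarith [hz0.1]
  · obtain ⟨n, rfl⟩ := Int.exists_eq_neg_ofNat h0.le
    have hn : (M : ℝ) + 1 ≤ n := by exact_mod_cast (by omega : M + 1 ≤ n)
    have hg := (ext_growth hz (-(n : ℤ)) n).1
    rw [neg_add_cancel] at hg
    have hmul : 39 / 50 * a * ((M : ℝ) + 1) ≤ 39 / 50 * a * n :=
      mul_le_mul_of_nonneg_left hn hlo
    have habs := neg_le_abs (z (-(n : ℤ)))
    linarith [hz0.2]

/-! ## Perturbing the data -/

/-- `‖e₃‖ = 1`. [folklore] -/
theorem ext_norm_layerNormal_one : ‖(layerNormal 1 : EuclideanSpace ℝ (Fin 3))‖ = 1 := by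
  rw [EuclideanSpace.norm_eq, Fin.sum_univ_three]
  simp [layerNormal]

/-- **Perturbing the data moves the points in a ball by little.** Let `(A, s, z)` be normalised
data (increments of `z` in `[39a/50, 17a/20]`, `z 0 ∈ [−17a/20, 0]`, `0 < a ≤ 1`) and
`R + 2 ≤ (39a/50) M`. If the word `s'` agrees with `s` on `|m| ≤ M`, the heights `z'` are within
`η/4` of `z` on `|m| ≤ M`, and the rigid motion `A'` is within `η/4` of `A` on `‖·‖ ≤ R + 1`,
then every point of the layered set of `(A, s, z)` in `‖·‖ ≤ R + 1` is within `η/2` of the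
layered set of `(A', s', z')` (the point with the same indices `(m, i, j)`). [folklore] -/
theorem ext_close_points {a R η : ℝ} {M : ℕ} (ha0 : 0 < a) (ha1 : a ≤ 1)
    (A A' : EuclideanSpace ℝ (Fin 3) →ₗᵢ[ℝ] EuclideanSpace ℝ (Fin 3)) (s s' : ℤ → ℤ)
    (z z' : ℤ → ℝ)
    (hz : ∀ m : ℤ, 39 / 50 * a ≤ z (m + 1) - z m ∧ z (m + 1) - z m ≤ 17 / 20 * a)
    (hz0 : -(17 / 20 * a) ≤ z 0 ∧ z 0 ≤ 0) (hM : R + 2 ≤ 39 / 50 * a * M)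
    (hss' : ∀ m : ℤ, |m| ≤ M → s m = s' m) (hzz' : ∀ m : ℤ, |m| ≤ M → |z m - z' m| ≤ η / 4)
    (hAA' : ∀ v : EuclideanSpace ℝ (Fin 3), ‖v‖ ≤ R + 1 → ‖A v - A' v‖ ≤ η / 4) :
    ∀ p ∈ {p : EuclideanSpace ℝ (Fin 3) | ∃ m i j : ℤ, p = A (((i : ℝ) • triangularVec₁ a) +
        ((j : ℝ) • triangularVec₂ a) + ((haggLabel s m : ℝ) • barlowOffset a) +
        (z m • layerNormal 1))}, ‖p‖ ≤ R + 1 →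
      ∃ p' ∈ {p : EuclideanSpace ℝ (Fin 3) | ∃ m i j : ℤ, p = A' (((i : ℝ) • triangularVec₁ a) +
        ((j : ℝ) • triangularVec₂ a) + ((haggLabel s' m : ℝ) • barlowOffset a) +
        (z' m • layerNormal 1))}, dist p p' ≤ η / 2 := by
  rintro p ⟨m, i, j, rfl⟩ hp
  have hm : |m| ≤ M :=
    ext_layer_bound ha0 ha1 hz hz0 hM ((ext_abs_height_le_norm A a _ _ i j).trans hp)
  have hL : haggLabel s m = haggLabel s' m := ext_haggLabel_eq_of_eqOn hss' m hm
  rw [A.norm_map] at hp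
  refine ⟨A' (((i : ℝ) • triangularVec₁ a) + ((j : ℝ) • triangularVec₂ a) +
    ((haggLabel s' m : ℝ) • barlowOffset a) + (z' m • layerNormal 1)), ⟨m, i, j, rfl⟩, ?_⟩
  have hqq' : ‖(((i : ℝ) • triangularVec₁ a) + ((j : ℝ) • triangularVec₂ a) +
      ((haggLabel s m : ℝ) • barlowOffset a) + (z m • layerNormal 1)) -
      (((i : ℝ) • triangularVec₁ a) + ((j : ℝ) • triangularVec₂ a) +
      ((haggLabel s' m : ℝ) • barlowOffset a) + (z' m • layerNormal 1))‖ ≤ η / 4 := by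
    rw [hL, show ∀ u v w e e' : EuclideanSpace ℝ (Fin 3), u + v + w + e - (u + v + w + e') = e - e'
      from fun u v w e e' => by abel, ← sub_smul, norm_smul, Real.norm_eq_abs,
      ext_norm_layerNormal_one, mul_one]
    exact hzz' m hm
  calc dist (A _) (A' _) ≤ dist (A _) (A' (((i : ℝ) • triangularVec₁ a) +
        ((j : ℝ) • triangularVec₂ a) + ((haggLabel s m : ℝ) • barlowOffset a) +
        (z m • layerNormal 1))) + dist (A' (((i : ℝ) • triangularVec₁ a) +
        ((j : ℝ) • triangularVec₂ a) + ((haggLabel s m : ℝ) • barlowOffset a) +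
        (z m • layerNormal 1))) (A' _) := dist_triangle _ _ _
    _ ≤ η / 4 + η / 4 := by
        refine add_le_add ?_ ?_
        · rw [dist_eq_norm]
          exact hAA' _ hp
        · rwa [dist_eq_norm, ← A'.map_sub, A'.norm_map]
    _ = η / 2 := by ring

/-- **Transferring a match to a nearby set.** If `S` and `S'` are two-way `η/2`-close on
`‖·‖ ≤ R + 1` (`η ≤ 1`) and `y + t` is two-way `η/2`-matched with `S` on `‖·‖ ≤ R + 1`, then
`y + t` is two-way `η`-matched with `S'` on `‖·‖ ≤ R`. [folklore] -/
theorem ext_match_perturb {N : ℕ} (y : Fin N → EuclideanSpace ℝ (Fin 3)) (t : EuclideanSpace ℝ (Fin 3))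
    (S S' : Set (EuclideanSpace ℝ (Fin 3))) {R η : ℝ} (hη1 : η ≤ 1)
    (hSS' : ∀ p ∈ S, ‖p‖ ≤ R + 1 → ∃ p' ∈ S', dist p p' ≤ η / 2)
    (hS'S : ∀ p' ∈ S', ‖p'‖ ≤ R + 1 → ∃ p ∈ S, dist p' p ≤ η / 2)
    (h : (∀ p ∈ S, ‖p‖ ≤ R + 1 → ∃ i : Fin N, dist (y i + t) p ≤ η / 2) ∧
      (∀ i : Fin N, ‖y i + t‖ ≤ R + 1 → ∃ p ∈ S, dist (y i + t) p ≤ η / 2)) :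
    (∀ p' ∈ S', ‖p'‖ ≤ R → ∃ i : Fin N, dist (y i + t) p' ≤ η) ∧
      (∀ i : Fin N, ‖y i + t‖ ≤ R → ∃ p' ∈ S', dist (y i + t) p' ≤ η) := by
  refine ⟨fun p' hp' hpR => ?_, fun i hi => ?_⟩
  · obtain ⟨p, hp, hd⟩ := hS'S p' hp' (by linarith)
    have hpn : ‖p‖ ≤ R + 1 := by
      have h1 := dist_triangle p p' (0 : EuclideanSpace ℝ (Fin 3))
      rw [dist_zero_right, dist_zero_right, dist_comm] at h1
      linarith
    obtain ⟨i, hi⟩ := h.1 p hp hpn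
    refine ⟨i, ?_⟩
    calc dist (y i + t) p' ≤ dist (y i + t) p + dist p p' := dist_triangle _ _ _
      _ ≤ η / 2 + η / 2 := add_le_add hi (by rwa [dist_comm])
      _ = η := by ring
  · obtain ⟨p, hp, hd⟩ := h.2 i (by linarith)
    have hpn : ‖p‖ ≤ R + 1 := by
      have h1 := dist_triangle p (y i + t) (0 : EuclideanSpace ℝ (Fin 3))
      rw [dist_zero_right, dist_zero_right, dist_comm] at h1
      linarith
    obtain ⟨p', hp', hd'⟩ := hSS' p hp hpn
    refine ⟨p', hp', ?_⟩
    calc dist (y i + t) p' ≤ dist (y i + t) p + dist p p' := dist_triangle _ _ _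
      _ ≤ η / 2 + η / 2 := add_le_add hd hd'
      _ = η := by ring

/-! ## The compact data space -/

/-- The linear isometries of `ℝ³`, as a subset of `ℝ³ →L[ℝ] ℝ³`, form a compact set (closed and
bounded in a finite-dimensional space). [folklore] -/
theorem ext_isCompact_isometries :
    IsCompact {L : EuclideanSpace ℝ (Fin 3) →L[ℝ] EuclideanSpace ℝ (Fin 3) | ∀ v, ‖L v‖ = ‖v‖} := by
  apply Metric.isCompact_of_isClosed_isBounded
  · rw [Set.setOf_forall]
    exact isClosed_iInter fun v => isClosed_eq (continuous_eval_const v).norm continuous_const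
  · refine (Metric.isBounded_closedBall (x := (0 : EuclideanSpace ℝ (Fin 3) →L[ℝ]
      EuclideanSpace ℝ (Fin 3))) (r := 1)).subset fun L hL => ?_
    rw [mem_closedBall_zero_iff]
    exact L.opNorm_le_bound zero_le_one fun v => by rw [hL v, one_mul]

/-- `{±1}^ℤ` is compact (Tychonoff). [folklore] -/
theorem ext_isCompact_words : IsCompact (Set.pi Set.univ fun _ : ℤ => ({1, -1} : Set ℤ)) :=
  isCompact_univ_pi fun _ => (Set.toFinite _).isCompact

/-- Normalised heights are bounded layer by layer: `|z m| ≤ (17a/20) (|m| + 1)`. [folklore] -/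
theorem ext_abs_height_le {z : ℤ → ℝ} {a : ℝ}
    (hz : ∀ m : ℤ, 39 / 50 * a ≤ z (m + 1) - z m ∧ z (m + 1) - z m ≤ 17 / 20 * a)
    (hz0 : -(17 / 20 * a) ≤ z 0 ∧ z 0 ≤ 0) (m : ℤ) : |z m| ≤ 17 / 20 * a * (|m| + 1) := by
  have ha : 0 ≤ a := by linarith [hz0.1, hz0.2]
  rw [abs_le]
  rcases le_or_gt 0 m with h0 | h0
  · obtain ⟨n, rfl⟩ := Int.eq_ofNat_of_zero_le h0
    have hg := ext_growth hz 0 n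
    rw [zero_add] at hg
    rw [show |((n : ℕ) : ℤ)| = n from abs_of_nonneg (by positivity)]
    push_cast
    have : (0 : ℝ) ≤ n := by positivity
    constructor <;> nlinarith [hg.1, hg.2, hz0.1, hz0.2]
  · obtain ⟨n, rfl⟩ := Int.exists_eq_neg_ofNat h0.le
    have hg := ext_growth hz (-(n : ℤ)) n
    rw [neg_add_cancel] at hg
    rw [show |(-(n : ℕ) : ℤ)| = n by rw [abs_neg]; exact abs_of_nonneg (by positivity)]
    push_cast
    have : (0 : ℝ) ≤ n := by positivity
    constructor <;> nlinarith [hg.1, hg.2, hz0.1, hz0.2]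

/-- Normalised height sequences (`z 0 ∈ [−17a/20, 0]`, increments in `[39a/50, 17a/20]`) form a
compact subset of `ℤ → ℝ` (closed, inside a product of compact intervals). [folklore] -/
theorem ext_isCompact_heights (a : ℝ) :
    IsCompact {z : ℤ → ℝ | (-(17 / 20 * a) ≤ z 0 ∧ z 0 ≤ 0) ∧
      ∀ m : ℤ, 39 / 50 * a ≤ z (m + 1) - z m ∧ z (m + 1) - z m ≤ 17 / 20 * a} := by
  refine IsCompact.of_isClosed_subset (isCompact_univ_pi fun m : ℤ =>
    (isCompact_Icc : IsCompact (Set.Icc (-(17 / 20 * a * (|(m : ℝ)| + 1)))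
      (17 / 20 * a * (|(m : ℝ)| + 1))))) ?_ ?_
  · simp only [Set.setOf_and, Set.setOf_forall]
    exact ((isClosed_le continuous_const (continuous_apply 0)).inter
      (isClosed_le (continuous_apply 0) continuous_const)).inter (isClosed_iInter fun m =>
        (isClosed_le continuous_const ((continuous_apply (m + 1)).sub (continuous_apply m))).inter
        (isClosed_le ((continuous_apply (m + 1)).sub (continuous_apply m)) continuous_const))
  · intro z hz
    rw [Set.mem_univ_pi]
    intro m
    have := ext_abs_height_le hz.2 hz.1 m
    rw [← Int.cast_abs] 
    exact abs_le.1 (by exact_mod_cast this)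

end Summit.AtomisticToContinuum.Crystallization.Theorems.LayeredHull

end
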